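import Literature.Probability.LatticeModels.IsoradialGraphs
import HarnessLib

/-!
# The square lattice as an isoradial graph: proofs

Trunk StatMech (prelude item P23 `IsoradialGraphs`). This file consists of theorems only and
discharges the square-lattice instance facts of
`Literature.Probability.LatticeModels.IsoradialGraphs` (named facts `def … : Prop` there, D-0014):

* `isIsoradial_squareLatticeEmbedding_holds : isIsoradial_squareLatticeEmbedding`,
* `hasBoundedAngles_squareLatticeEmbedding_holds : hasBoundedAngles_squareLatticeEmbedding`
  (via `halfAngle_squareLatticeEmbedding : halfAngle d = π/4` for every dart),
* `isSimpleTrack_squareAntidiagTrack_holds`, `isSimpleTrack_squareDiagTrack_holds`,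
* `hasSquareGridProperty_squareLattice_holds : hasSquareGridProperty_squareLattice`.

These are four of the six facts putting `ℤ²` at `p = 1/2` in Grimmett–Manolescu's class `𝒢`
(the trust base of `hasCrossingLimit_squareLattice_of_cardyUniversality` in
`Percolation/CardyFormula` and of `isoradialPercolation_square_eq` / `square_boxCrossing` in
`Percolation/Isoradial`); the remaining two (`isoradialPercolation_squareLattice`,
`isRhombicTiling_squareLatticeEmbedding`) are discharged in sibling proof files, and
`zdGraph_preconnected` in `LatticeGraph`.

## Proof architecture

* **One computation** (`squareLattice_dart_geometry`): for a dart `d = (x → y)` of `ℤ²` with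
  step direction `u ∈ {1, i, -1, -i}`, `z y - z x = √2 u` and the two adjacent face centres are
  `z x + √2 u (1 ± i)/2`. Isoradiality, `halfAngle = |arg ((1 + i)/2)| = π/4` and (in the sibling
  file) the critical weight `1/2` follow.
* **Tracks in coordinates.** `(k, n) ↦ squareAntidiagTrack k n` is a bijection from `ℤ × ℤ` to
  the edges (rhombi) of `ℤ²` (`exists_eq_squareAntidiagTrack`, `squareAntidiagTrack_inj`), and
  `squareDiagTrack k n = squareAntidiagTrack (k + n) n` (`squareDiagTrack_eq`). In the
  coordinates `(x₀ + x₁, x₀ - x₁)` the rhombus `squareAntidiagTrack k n` is the unit square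
  `[k, k+1] × [k-n, k-n+1]`; its sides (`mem_sides_squareAntidiagTrack_iff`) are the sides of
  that square and the opposite-side map is the central reflection
  (`oppositeSide_squareAntidiagTrack`); both are computed once from `dartSides` /
  `dartOppositeSide` of an explicit dart, using isoradiality to forget the reference dart
  (`sides_eq_dartSides`, `oppositeSide_eq_dartOppositeSide`). Everything else is linear
  arithmetic over `ℤ` (`omega`).
* **Classification** (`isTrack_squareLattice_classification`): every train track of `ℤ²` is a
  diagonal or an antidiagonal traversed monotonically, whence the betweenness clauses of the
  square-grid property; the other clauses are explicit index computations (meetings of `s i`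
  and `t j` at index `i - j`, separation bound `M = 0`).

## References

* G. R. Grimmett, I. Manolescu, *Bond percolation on isoradial graphs: criticality and
  universality*, Probab. Theory Related Fields 159 (2014) 273–327, §1 (the class `𝒢` "includes
  `ℤ²`"), §2.1 (isoradial graphs and rhombic tilings), §2.4 (square grids; "the square lattice
  has the square grid property").
* N. G. de Bruijn, *Algebraic theory of Penrose's non-periodic tilings of the plane*, Indag.
  Math. 43 (1981) (tracks / "ribbons").
* R. Kenyon, J.-M. Schlenker, *Rhombic embeddings of planar quad-graphs*, Trans. AMS 357 (2005).
-/

namespace Literature.Probability.LatticeModels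

open Complex

/-- The first unit vector of `ℤ²` is sent to `1 ∈ ℂ`. [folklore] -/
theorem Site.toComplex_single_zero : Site.toComplex (Pi.single 0 1 : Site 2) = 1 := by
  apply Complex.ext <;> simp [Site.toComplex]

/-- The second unit vector of `ℤ²` is sent to `i ∈ ℂ`. [folklore] -/
theorem Site.toComplex_single_one : Site.toComplex (Pi.single 1 1 : Site 2) = I := by
  apply Complex.ext <;> simp [Site.toComplex]

/-- `Site.toComplex : ℤ² → ℂ` is injective. [folklore] -/
theorem Site.toComplex_injective : Function.Injective (Site.toComplex) := by
  intro x y h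
  have h0 := congrArg Complex.re h
  have h1 := congrArg Complex.im h
  simp only [Site.toComplex_re, Site.toComplex_im, Int.cast_inj] at h0 h1
  funext i
  fin_cases i
  · exact h0
  · exact h1

/-- The four kinds of darts of `ℤ²`: east, north, west, south steps. (Friedli–Velenik 2017, §3.1.) [cite: FriedliVelenik2017, §3.1] -/
theorem zdGraph_two_dart_cases (d : (zdGraph 2).Dart) :
    d.snd = d.fst + Pi.single 0 1 ∨ d.snd = d.fst + Pi.single 1 1 ∨
      d.fst = d.snd + Pi.single 0 1 ∨ d.fst = d.snd + Pi.single 1 1 := by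
  obtain ⟨i, h | h⟩ := (zdGraph_adj_iff d.fst d.snd).1 d.adj
  · fin_cases i
    · exact Or.inl h
    · exact Or.inr (Or.inl h)
  · fin_cases i
    · exact Or.inr (Or.inr (Or.inl h))
    · exact Or.inr (Or.inr (Or.inr h))

/-- The two unit vectors of `ℤ²` are distinct. [folklore] -/
theorem single_zero_ne_single_one : (Pi.single 0 1 : Site 2) ≠ Pi.single 1 1 := by
  intro h
  have := congrFun h 0
  simp at this

/-- Face bookkeeping of `squareLeftFace`: the square to the left of the east step `x → x + e₀` is
the one with lower-left corner `x`. (Grimmett–Manolescu 2014, §2.1, the square lattice.) [cite: GrimmettManolescu2014, §2.1] -/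
theorem squareLeftFace_east (x : Site 2) : squareLeftFace x (x + Pi.single 0 1) = x := by
  simp [squareLeftFace]

/-- The square to the left of the north step `x → x + e₁` has lower-left corner `x - e₀`.
(Grimmett–Manolescu 2014, §2.1.) [cite: GrimmettManolescu2014, §2.1] -/
theorem squareLeftFace_north (x : Site 2) :
    squareLeftFace x (x + Pi.single 1 1) = x - Pi.single 0 1 := by
  have h1 : x + Pi.single 1 1 ≠ x + Pi.single 0 1 := by
    intro h; exact single_zero_ne_single_one (add_left_cancel h).symm
  simp [squareLeftFace, h1]

/-- The square to the left of the west step `y + e₀ → y` has lower-left corner `y - e₁`.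
(Grimmett–Manolescu 2014, §2.1.) [cite: GrimmettManolescu2014, §2.1] -/
theorem squareLeftFace_west (y : Site 2) :
    squareLeftFace (y + Pi.single 0 1) y = y - Pi.single 1 1 := by
  have h1 : y ≠ y + Pi.single 0 1 + Pi.single 0 1 := by
    intro h; have := congrFun h 0; simp at this; omega
  have h2 : y ≠ y + Pi.single 0 1 + Pi.single 1 1 := by
    intro h; have := congrFun h 0; simp at this
  simp [squareLeftFace, h1, h2]

/-- The square to the left of the south step `y + e₁ → y` has lower-left corner `y`.
(Grimmett–Manolescu 2014, §2.1.) [cite: GrimmettManolescu2014, §2.1] -/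
theorem squareLeftFace_south (y : Site 2) :
    squareLeftFace (y + Pi.single 1 1) y = y := by
  have h1 : y ≠ y + Pi.single 1 1 + Pi.single 0 1 := by
    intro h; have := congrFun h 1; simp at this
  have h2 : y ≠ y + Pi.single 1 1 + Pi.single 1 1 := by
    intro h; have := congrFun h 1; simp at this; omega
  have h3 : y + Pi.single 1 1 ≠ y + Pi.single 0 1 := by
    intro h; exact single_zero_ne_single_one (add_left_cancel h).symm
  simp [squareLeftFace, h1, h2, h3]

/-- Unfolding the vertex positions of `squareLatticeEmbedding`. (Grimmett–Manolescu 2014, §2.1.) [cite: GrimmettManolescu2014, §2.1] -/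
theorem squareLatticeEmbedding_z (x : Site 2) :
    squareLatticeEmbedding.z x = Real.sqrt 2 * Site.toComplex x := rfl

/-- Unfolding the face-centre positions of `squareLatticeEmbedding`. (Grimmett–Manolescu 2014,
§2.1.) [cite: GrimmettManolescu2014, §2.1] -/
theorem squareLatticeEmbedding_c (f : Site 2) :
    squareLatticeEmbedding.c f = Real.sqrt 2 * (Site.toComplex f + (1 + I) / 2) := rfl

/-- Unfolding the left faces of `squareLatticeEmbedding`. (Grimmett–Manolescu 2014, §2.1.) [cite: GrimmettManolescu2014, §2.1] -/
theorem squareLatticeEmbedding_leftFace (d : (zdGraph 2).Dart) :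
    squareLatticeEmbedding.leftFace d = squareLeftFace d.fst d.snd := rfl

/-- Unfolding the right faces of `squareLatticeEmbedding` (`rightFace d = leftFace d.symm` by
definition). (Grimmett–Manolescu 2014, §2.1.) [cite: GrimmettManolescu2014, §2.1] -/
theorem squareLatticeEmbedding_rightFace (d : (zdGraph 2).Dart) :
    squareLatticeEmbedding.rightFace d = squareLeftFace d.snd d.fst := rfl

/-- **The rhombus of a dart of `ℤ²`, in coordinates.** For every dart `d = (x → y)` there is a unit
`u ∈ {1, i, -1, -i}` (the direction of the step) with `z y - z x = √2 u`, `c (leftFace d) - z x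
= √2 u (1 + i)/2` and `c (rightFace d) - z x = √2 u (1 - i)/2`: the two adjacent face centres
sit at `45°` on either side of the edge, at distance `1` from both endpoints. This single
computation feeds isoradiality, the half-angles and the critical weights of the square lattice.
(Grimmett–Manolescu 2014, §2.1, the square lattice as an isoradial graph.) [cite: GrimmettManolescu2014, §2.1] -/
theorem squareLattice_dart_geometry (d : (zdGraph 2).Dart) :
    ∃ u : ℂ, (u = 1 ∨ u = I ∨ u = -1 ∨ u = -I) ∧
      squareLatticeEmbedding.z d.snd - squareLatticeEmbedding.z d.fst = Real.sqrt 2 * u ∧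
      squareLatticeEmbedding.c (squareLatticeEmbedding.leftFace d) - squareLatticeEmbedding.z d.fst
        = Real.sqrt 2 * u * ((1 + I) / 2) ∧
      squareLatticeEmbedding.c (squareLatticeEmbedding.rightFace d) -
          squareLatticeEmbedding.z d.fst = Real.sqrt 2 * u * ((1 - I) / 2) := by
  obtain ⟨⟨x, y⟩, hxy⟩ := d
  simp only [squareLatticeEmbedding_z, squareLatticeEmbedding_c, squareLatticeEmbedding_leftFace,
    squareLatticeEmbedding_rightFace]
  rcases zdGraph_two_dart_cases ⟨⟨x, y⟩, hxy⟩ with h | h | h | h <;> simp only at h <;> subst h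
  · refine ⟨1, by simp, ?_, ?_, ?_⟩ <;>
      apply Complex.ext <;> simp [squareLeftFace_east, squareLeftFace_west] <;> ring
  · refine ⟨I, by simp, ?_, ?_, ?_⟩ <;>
      apply Complex.ext <;> simp [squareLeftFace_north, squareLeftFace_south] <;> ring
  · refine ⟨-1, by simp, ?_, ?_, ?_⟩ <;>
      apply Complex.ext <;> simp [squareLeftFace_east, squareLeftFace_west] <;> ring
  · refine ⟨-I, by simp, ?_, ?_, ?_⟩ <;>
      apply Complex.ext <;> simp [squareLeftFace_north, squareLeftFace_south] <;> ring

/-- `‖1 + i‖ = √2`. [folklore] -/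
theorem norm_one_add_I : ‖(1 : ℂ) + I‖ = Real.sqrt 2 := by
  rw [Complex.norm_def, Complex.normSq_apply]; simp; norm_num

/-- `‖1 - i‖ = √2`. [folklore] -/
theorem norm_one_sub_I : ‖(1 : ℂ) - I‖ = Real.sqrt 2 := by
  rw [Complex.norm_def, Complex.normSq_apply]; simp; norm_num

/-- `√2 · (√2 / 2) = 1`. [folklore] -/
theorem sqrt_two_mul_sqrt_two_div_two : Real.sqrt 2 * (Real.sqrt 2 / 2) = 1 := by
  rw [← mul_div_assoc, Real.mul_self_sqrt (by norm_num : (0 : ℝ) ≤ 2)]; norm_num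

/-- **`ℤ²` is isoradially embedded** — discharge of the named fact
`isIsoradial_squareLatticeEmbedding`: corner–centre distances are `‖√2 u (1 ± i)/2‖ = 1`,
reversing a dart swaps the two faces by definition, the two face centres differ by `√2 u i ≠ 0`,
and `x ↦ √2 (x₀ + i x₁)` is injective. (Grimmett–Manolescu, PTRF 159 (2014), §2.1: the square
lattice is isoradial.) [cite: GrimmettManolescu2014, §2.1] -/
theorem isIsoradial_squareLatticeEmbedding_holds : isIsoradial_squareLatticeEmbedding := by
  refine ⟨?_, ?_, ?_, ?_⟩
  · intro d
    obtain ⟨u, hu, h1, h2, -⟩ := squareLattice_dart_geometry d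
    have hu1 : ‖u‖ = 1 := by rcases hu with rfl | rfl | rfl | rfl <;> simp
    constructor
    · rw [← norm_neg, neg_sub, h2, norm_mul, norm_mul, hu1, norm_div, norm_one_add_I,
        Complex.norm_real, Real.norm_of_nonneg (Real.sqrt_nonneg _)]
      simp [sqrt_two_mul_sqrt_two_div_two]
    · have : squareLatticeEmbedding.z d.snd -
          squareLatticeEmbedding.c (squareLatticeEmbedding.leftFace d) =
            Real.sqrt 2 * u * ((1 - I) / 2) := by
        linear_combination h1 - h2
      rw [this, norm_mul, norm_mul, hu1, norm_div, norm_one_sub_I, Complex.norm_real,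
        Real.norm_of_nonneg (Real.sqrt_nonneg _)]
      simp [sqrt_two_mul_sqrt_two_div_two]
  · intro d; rfl
  · intro d h
    obtain ⟨u, hu, -, h2, h3⟩ := squareLattice_dart_geometry d
    have hu0 : u ≠ 0 := by rcases hu with rfl | rfl | rfl | rfl <;> simp [I_ne_zero]
    have hs : (Real.sqrt 2 : ℂ) ≠ 0 := by
      exact_mod_cast Real.sqrt_ne_zero'.2 (by norm_num)
    have : squareLatticeEmbedding.c (squareLatticeEmbedding.leftFace d) -
        squareLatticeEmbedding.c (squareLatticeEmbedding.rightFace d) = Real.sqrt 2 * u * I := by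
      linear_combination h2 - h3
    rw [h, sub_self] at this
    exact (mul_ne_zero (mul_ne_zero hs hu0) I_ne_zero) this.symm
  · intro x y h
    have hs : (Real.sqrt 2 : ℂ) ≠ 0 := by
      exact_mod_cast Real.sqrt_ne_zero'.2 (by norm_num)
    exact Site.toComplex_injective (mul_left_cancel₀ hs h)

/-- **Every rhombus half-angle of `ℤ²` is `π/4`**: the ratio `(c (leftFace d) - z x) / (z y - z x)`
equals `(1 + i)/2 = (√2/2) e^{iπ/4}` for every dart. (Grimmett–Manolescu 2014, §2.1 and §1 after
the definition of `p_e`: on `ℤ²` every edge subtends a right angle at the circumcentres, `θ_e =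
π/2`, i.e. half-angle `π/4` at the vertex.) [cite: GrimmettManolescu2014, §2.1] -/
theorem halfAngle_squareLatticeEmbedding (d : (zdGraph 2).Dart) :
    squareLatticeEmbedding.halfAngle d = Real.pi / 4 := by
  obtain ⟨u, hu, h1, h2, -⟩ := squareLattice_dart_geometry d
  have hu0 : u ≠ 0 := by rcases hu with rfl | rfl | rfl | rfl <;> simp [I_ne_zero]
  have hs : (Real.sqrt 2 : ℂ) ≠ 0 := by
    exact_mod_cast Real.sqrt_ne_zero'.2 (by norm_num)
  unfold RhombicEmbedding.halfAngle
  rw [h2, h1]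
  have h3 : Real.sqrt 2 * u * ((1 + I) / 2) / (Real.sqrt 2 * u) = (1 + I) / 2 := by
    field_simp
  rw [h3]
  have h14 : (1 + I) / 2 =
      ((Real.sqrt 2 / 2 : ℝ) : ℂ) * (Complex.cos ((Real.pi / 4 : ℝ) : ℂ) +
        Complex.sin ((Real.pi / 4 : ℝ) : ℂ) * I) := by
    rw [← Complex.ofReal_cos, ← Complex.ofReal_sin, Real.cos_pi_div_four, Real.sin_pi_div_four]
    push_cast
    have h22 : (Real.sqrt 2 : ℂ) * Real.sqrt 2 = 2 := by
      exact_mod_cast Real.mul_self_sqrt (by norm_num : (0 : ℝ) ≤ 2)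
    linear_combination (-(1 + I) / 4) * h22
  rw [h14, Complex.arg_mul_cos_add_sin_mul_I (by positivity)
    ⟨by linarith [Real.pi_pos], by linarith [Real.pi_pos]⟩]
  exact abs_of_pos (by positivity)

/-- **`ℤ²` has the bounded-angles property `BAP(ε)` for every `ε ≤ π/4`** — discharge of the
named fact `hasBoundedAngles_squareLatticeEmbedding` (all half-angles equal `π/4`).
(Grimmett–Manolescu 2014, §1 and §2.1.) [cite: GrimmettManolescu2014, §2.1] -/
theorem hasBoundedAngles_squareLatticeEmbedding_holds :
    hasBoundedAngles_squareLatticeEmbedding := by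
  intro ε hε d
  rw [halfAngle_squareLatticeEmbedding]
  constructor <;> linarith

/-! ### Vector bookkeeping on `Site 2 = Fin 2 → ℤ` -/

/-- A site of `ℤ²` equals `![a, b]` iff its two coordinates are `a` and `b` (bookkeeping between
`Fin 2 → ℤ` and vector notation). [folklore] -/
theorem vec2_eq_iff (v : Site 2) (a b : ℤ) : v = ![a, b] ↔ v 0 = a ∧ v 1 = b := by
  constructor
  · rintro rfl; simp
  · rintro ⟨h0, h1⟩; funext i; fin_cases i <;> simp [h0, h1]

/-- `(a, b) + e₀ = (a + 1, b)`. [folklore] -/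
theorem vec2_add_single_zero (a b : ℤ) : ![a, b] + Pi.single 0 1 = ![a + 1, b] := by
  funext i; fin_cases i <;> simp

/-- `(a, b) + e₁ = (a, b + 1)`. [folklore] -/
theorem vec2_add_single_one (a b : ℤ) : ![a, b] + Pi.single 1 1 = ![a, b + 1] := by
  funext i; fin_cases i <;> simp

/-- `(a, b) - e₀ = (a - 1, b)`. [folklore] -/
theorem vec2_sub_single_zero (a b : ℤ) : ![a, b] - Pi.single 0 1 = ![a - 1, b] := by
  funext i; fin_cases i <;> simp

/-- `(a, b) - e₁ = (a, b - 1)`. [folklore] -/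
theorem vec2_sub_single_one (a b : ℤ) : ![a, b] - Pi.single 1 1 = ![a, b - 1] := by
  funext i; fin_cases i <;> simp

/-- Horizontal neighbours of `ℤ²` are adjacent. (Friedli–Velenik 2017, §3.1.) [cite: FriedliVelenik2017, §3.1] -/
theorem zdGraph_two_adj_east (a b : ℤ) : (zdGraph 2).Adj ![a, b] ![a + 1, b] :=
  (zdGraph_adj_iff _ _).2 ⟨0, Or.inl (vec2_add_single_zero a b).symm⟩

/-- Vertical neighbours of `ℤ²` are adjacent. (Friedli–Velenik 2017, §3.1.) [cite: FriedliVelenik2017, §3.1] -/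
theorem zdGraph_two_adj_north (a b : ℤ) : (zdGraph 2).Adj ![a, b] ![a, b + 1] :=
  (zdGraph_adj_iff _ _).2 ⟨1, Or.inl (vec2_add_single_one a b).symm⟩

/-! ### Every rhombus of `ℤ²` lies on a unique antidiagonal track, at a unique index -/

/-- Even-indexed rhombi of an antidiagonal track are horizontal edges. (Grimmett–Manolescu 2014,
§2.1 and §2.4: the tracks of `ℤ²` are its diagonals.) [cite: GrimmettManolescu2014, §2.4] -/
theorem squareAntidiagTrack_of_even {k n : ℤ} (hn : n % 2 = 0) :
    squareAntidiagTrack k n = squareHorizEdge (k - n / 2) (n / 2) := by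
  simp [squareAntidiagTrack, hn]

/-- Odd-indexed rhombi of an antidiagonal track are vertical edges. (Grimmett–Manolescu 2014, §2.4.) [cite: GrimmettManolescu2014, §2.4] -/
theorem squareAntidiagTrack_of_odd {k n : ℤ} (hn : n % 2 = 1) :
    squareAntidiagTrack k n = squareVertEdge (k - n / 2) (n / 2) := by
  simp [squareAntidiagTrack, hn]

/-- **Reparametrisation.** The `n`-th rhombus of the `k`-th diagonal track is the `n`-th rhombus of
the `(k + n)`-th antidiagonal track: every rhombus of `ℤ²` lies on exactly one track of each
family, and `(k, n) ↦ squareAntidiagTrack k n` parametrises the rhombi (edges) of `ℤ²` by the pair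
(antidiagonal index, position), the diagonal index being `k - n`. (Grimmett–Manolescu 2014, §2.4.) [cite: GrimmettManolescu2014, §2.4] -/
theorem squareDiagTrack_eq (k n : ℤ) : squareDiagTrack k n = squareAntidiagTrack (k + n) n := by
  unfold squareDiagTrack squareAntidiagTrack
  rcases Int.emod_two_eq_zero_or_one n with hn | hn
  · simp only [hn, if_true]
    congr 1; omega
  · simp only [hn, one_ne_zero, if_false]
    congr 1; omega

/-- The horizontal edge as an unordered pair. (Grimmett–Manolescu 2014, §2.1.) [cite: GrimmettManolescu2014, §2.1] -/
theorem coe_squareHorizEdge (a b : ℤ) :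
    ((squareHorizEdge a b : (zdGraph 2).edgeSet) : Sym2 (Site 2)) = s(![a, b], ![a + 1, b]) := rfl

/-- The vertical edge as an unordered pair. (Grimmett–Manolescu 2014, §2.1.) [cite: GrimmettManolescu2014, §2.1] -/
theorem coe_squareVertEdge (a b : ℤ) :
    ((squareVertEdge a b : (zdGraph 2).edgeSet) : Sym2 (Site 2)) = s(![a, b], ![a, b + 1]) := rfl

/-- The four ways two sites of `ℤ²` can be adjacent. (Friedli–Velenik 2017, §3.1.) [cite: FriedliVelenik2017, §3.1] -/
theorem zdGraph_two_adj_cases {x y : Site 2} (h : (zdGraph 2).Adj x y) :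
    y = x + Pi.single 0 1 ∨ y = x + Pi.single 1 1 ∨
      x = y + Pi.single 0 1 ∨ x = y + Pi.single 1 1 := by
  obtain ⟨i, h | h⟩ := (zdGraph_adj_iff x y).1 h
  · fin_cases i
    · exact Or.inl h
    · exact Or.inr (Or.inl h)
  · fin_cases i
    · exact Or.inr (Or.inr (Or.inl h))
    · exact Or.inr (Or.inr (Or.inr h))

/-- **Every rhombus of `ℤ²` lies on an antidiagonal track**: every edge is `squareAntidiagTrack k n`
for some `k` (the antidiagonal `x₀ + x₁ = k` it joins to `x₀ + x₁ = k + 1`) and `n` (`k - n` being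
the diagonal it joins to the next one). (Grimmett–Manolescu 2014, §2.4: the track system of `ℤ²`
consists of its diagonals and antidiagonals.) [cite: GrimmettManolescu2014, §2.4] -/
theorem exists_eq_squareAntidiagTrack (e : (zdGraph 2).edgeSet) :
    ∃ k n : ℤ, e = squareAntidiagTrack k n := by
  obtain ⟨e, he⟩ := e
  induction e using Sym2.ind with
  | h x y =>
    rw [SimpleGraph.mem_edgeSet] at he
    rcases zdGraph_two_adj_cases he with h | h | h | h
    · refine ⟨x 0 + x 1, 2 * x 1, Subtype.ext ?_⟩
      rw [squareAntidiagTrack_of_even (by omega), coe_squareHorizEdge]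
      subst h
      change s(x, x + Pi.single 0 1) = _
      rw [Sym2.eq_iff]; left
      constructor <;> funext i <;> fin_cases i <;> simp
    · refine ⟨x 0 + x 1, 2 * x 1 + 1, Subtype.ext ?_⟩
      rw [squareAntidiagTrack_of_odd (by omega), coe_squareVertEdge]
      subst h
      change s(x, x + Pi.single 1 1) = _
      rw [Sym2.eq_iff]; left
      constructor <;> funext i <;> fin_cases i <;> simp <;> omega
    · refine ⟨y 0 + y 1, 2 * y 1, Subtype.ext ?_⟩
      rw [squareAntidiagTrack_of_even (by omega), coe_squareHorizEdge]
      subst h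
      change s(y + Pi.single 0 1, y) = _
      rw [Sym2.eq_iff]; right
      constructor <;> funext i <;> fin_cases i <;> simp
    · refine ⟨y 0 + y 1, 2 * y 1 + 1, Subtype.ext ?_⟩
      rw [squareAntidiagTrack_of_odd (by omega), coe_squareVertEdge]
      subst h
      change s(y + Pi.single 1 1, y) = _
      rw [Sym2.eq_iff]; right
      constructor <;> funext i <;> fin_cases i <;> simp <;> omega

/-- **… at a unique position of a unique track**: `squareAntidiagTrack` is injective in `(k, n)`
(read off `k` as the smaller coordinate sum of the two endpoints and `k - n` as the smaller
coordinate difference). (Grimmett–Manolescu 2014, §2.4.) [cite: GrimmettManolescu2014, §2.4] -/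
theorem squareAntidiagTrack_inj {k n k' n' : ℤ}
    (h : squareAntidiagTrack k n = squareAntidiagTrack k' n') : k = k' ∧ n = n' := by
  -- symmetric invariants of an edge: min of coordinate sums, min of coordinate differences
  let S : Sym2 (Site 2) → ℤ :=
    Sym2.lift ⟨fun x y => min (x 0 + x 1) (y 0 + y 1), fun x y => min_comm _ _⟩
  let D : Sym2 (Site 2) → ℤ :=
    Sym2.lift ⟨fun x y => min (x 0 - x 1) (y 0 - y 1), fun x y => min_comm _ _⟩
  have hS : ∀ k n : ℤ, S (squareAntidiagTrack k n) = k := by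
    intro k n
    rcases Int.emod_two_eq_zero_or_one n with hn | hn
    · rw [squareAntidiagTrack_of_even hn, coe_squareHorizEdge]
      simp [S]; omega
    · rw [squareAntidiagTrack_of_odd hn, coe_squareVertEdge]
      simp [S]; omega
  have hD : ∀ k n : ℤ, D (squareAntidiagTrack k n) = k - n := by
    intro k n
    rcases Int.emod_two_eq_zero_or_one n with hn | hn
    · rw [squareAntidiagTrack_of_even hn, coe_squareHorizEdge]
      simp [D]; omega
    · rw [squareAntidiagTrack_of_odd hn, coe_squareVertEdge]
      simp [D]; omega
  have h1 := hS k n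
  have h2 := hD k n
  rw [h, hS] at h1
  rw [h, hD] at h2
  omega

/-! ### Sides of the rhombi of `ℤ²` -/

/-- **The sides of a rhombus of `ℤ²`, in coordinates.** In the coordinates `(x₀ + x₁, x₀ - x₁)` for
vertices and `(f₀ + f₁ + 1, f₀ - f₁)` for faces (indexed by lower-left corners), the rhombus
`squareAntidiagTrack k n` is the unit square `[k, k + 1] × [k - n, k - n + 1]`, its primal corners
being the two corners of even coordinate sum and its dual corners the two of odd sum; a pair
(vertex, face) is a side iff both are corners of this square. Computed from `dartSides` of an
explicit dart over the edge (east dart for horizontal, north dart for vertical edges), using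
`sides_eq_dartSides` and isoradiality. (de Bruijn 1981; Grimmett–Manolescu 2014, §2.1, the diamond
graph of `ℤ²`.) [cite: GrimmettManolescu2014, §2.1] -/
theorem mem_sides_squareAntidiagTrack_iff {k n : ℤ} {v f : Site 2} :
    (v, f) ∈ squareLatticeEmbedding.sides (squareAntidiagTrack k n) ↔
      (v 0 + v 1 = k ∨ v 0 + v 1 = k + 1) ∧ (v 0 - v 1 = k - n ∨ v 0 - v 1 = k - n + 1) ∧
      (f 0 + f 1 + 1 = k ∨ f 0 + f 1 = k) ∧ (f 0 - f 1 = k - n ∨ f 0 - f 1 = k - n + 1) := by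
  rcases Int.emod_two_eq_zero_or_one n with hn | hn
  · have hd : (⟨(![k - n / 2, n / 2], ![k - n / 2 + 1, n / 2]), zdGraph_two_adj_east _ _⟩ :
        (zdGraph 2).Dart).edge =
          ((squareAntidiagTrack k n : (zdGraph 2).edgeSet) : Sym2 (Site 2)) := by
      rw [squareAntidiagTrack_of_even hn]; rfl
    rw [squareLatticeEmbedding.sides_eq_dartSides isIsoradial_squareLatticeEmbedding_holds hd]
    simp only [RhombicEmbedding.dartSides, squareLatticeEmbedding_leftFace,
      squareLatticeEmbedding_rightFace]
    rw [← vec2_add_single_zero, squareLeftFace_east, squareLeftFace_west, vec2_add_single_zero,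
      vec2_sub_single_one]
    simp only [Finset.mem_insert, Finset.mem_singleton, Prod.mk.injEq, vec2_eq_iff]
    omega
  · have hd : (⟨(![k - n / 2, n / 2], ![k - n / 2, n / 2 + 1]), zdGraph_two_adj_north _ _⟩ :
        (zdGraph 2).Dart).edge =
          ((squareAntidiagTrack k n : (zdGraph 2).edgeSet) : Sym2 (Site 2)) := by
      rw [squareAntidiagTrack_of_odd hn]; rfl
    rw [squareLatticeEmbedding.sides_eq_dartSides isIsoradial_squareLatticeEmbedding_holds hd]
    simp only [RhombicEmbedding.dartSides, squareLatticeEmbedding_leftFace,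
      squareLatticeEmbedding_rightFace]
    rw [← vec2_add_single_one, squareLeftFace_north, squareLeftFace_south, vec2_add_single_one,
      vec2_sub_single_zero]
    simp only [Finset.mem_insert, Finset.mem_singleton, Prod.mk.injEq, vec2_eq_iff]
    omega

/-- Under isoradiality, `emb.oppositeSide e` may be computed from any dart over `e`
(companion of `sides_eq_dartSides`). (Grimmett–Manolescu 2014, §2.1: tracks and sides are
attached to unoriented edges.) [cite: GrimmettManolescu2014, §2.1] -/
theorem RhombicEmbedding.oppositeSide_eq_dartOppositeSide {V F : Type*} [DecidableEq V]
    [DecidableEq F] {G : SimpleGraph V} (emb : RhombicEmbedding G F) (h : emb.IsIsoradial)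
    {d : G.Dart} {e : G.edgeSet} (hd : d.edge = e) :
    emb.oppositeSide e = emb.dartOppositeSide d := by
  unfold RhombicEmbedding.oppositeSide
  have h' : (RhombicEmbedding.refDart e).edge = d.edge := by
    rw [RhombicEmbedding.refDart_edge, hd]
  rcases (SimpleGraph.dart_edge_eq_iff _ _).1 h' with h'' | h''
  · rw [h'']
  · rw [h'', emb.dartOppositeSide_symm h]

/-- The opposite-side map of a rhombus evaluated on its four sides (valid whenever the two
faces of the dart are distinct). (de Bruijn 1981; Grimmett–Manolescu 2014, §2.1: a track crosses
each rhombus from a side to the opposite side.) [cite: GrimmettManolescu2014, §2.1] -/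
theorem RhombicEmbedding.dartOppositeSide_apply {V F : Type*} [DecidableEq V] [DecidableEq F]
    {G : SimpleGraph V} (emb : RhombicEmbedding G F) (d : G.Dart)
    (h : emb.leftFace d ≠ emb.rightFace d) :
    emb.dartOppositeSide d (d.fst, emb.leftFace d) = (d.snd, emb.rightFace d) ∧
      emb.dartOppositeSide d (d.snd, emb.rightFace d) = (d.fst, emb.leftFace d) ∧
      emb.dartOppositeSide d (d.snd, emb.leftFace d) = (d.fst, emb.rightFace d) ∧
      emb.dartOppositeSide d (d.fst, emb.rightFace d) = (d.snd, emb.leftFace d) := by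
  have := d.fst_ne_snd
  unfold RhombicEmbedding.dartOppositeSide
  refine ⟨?_, ?_, ?_, ?_⟩ <;> split_ifs <;> simp_all

/-- **The opposite-side map of a rhombus of `ℤ²`, in coordinates**: on the sides of the rhombus
`squareAntidiagTrack k n` it is the point reflection through the centre of the rhombus (the square
`[k, k + 1] × [k - n, k - n + 1]` in the coordinates of `mem_sides_squareAntidiagTrack_iff`),
written out on the vertex and on the face component. (de Bruijn 1981; Grimmett–Manolescu 2014,
§2.1: a track crosses each rhombus between opposite sides.) [cite: GrimmettManolescu2014, §2.1] -/
theorem oppositeSide_squareAntidiagTrack {k n : ℤ} {v f : Site 2}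
    (h : (v, f) ∈ squareLatticeEmbedding.sides (squareAntidiagTrack k n)) :
    squareLatticeEmbedding.oppositeSide (squareAntidiagTrack k n) (v, f) =
      (![2 * k - n + 1 - v 0, n - v 1], ![2 * k - n - f 0, n - 1 - f 1]) := by
  have h' := mem_sides_squareAntidiagTrack_iff.1 h
  clear h
  rcases Int.emod_two_eq_zero_or_one n with hn | hn
  · -- horizontal rhombus, east dart `(a, b) → (a + 1, b)` with `a = k - n/2`, `b = n/2`
    have hv1 : v 1 = n / 2 := by omega
    have hf0 : f 0 = k - n / 2 := by omega
    have hv0 : v 0 = k - n / 2 ∨ v 0 = k - n / 2 + 1 := by omega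
    have hf1 : f 1 = n / 2 ∨ f 1 = n / 2 - 1 := by omega
    clear h'
    have hd : (⟨(![k - n / 2, n / 2], ![k - n / 2 + 1, n / 2]), zdGraph_two_adj_east _ _⟩ :
        (zdGraph 2).Dart).edge =
          ((squareAntidiagTrack k n : (zdGraph 2).edgeSet) : Sym2 (Site 2)) := by
      rw [squareAntidiagTrack_of_even hn]; rfl
    rw [squareLatticeEmbedding.oppositeSide_eq_dartOppositeSide
      isIsoradial_squareLatticeEmbedding_holds hd]
    have hL : squareLatticeEmbedding.leftFace
        (⟨(![k - n / 2, n / 2], ![k - n / 2 + 1, n / 2]), zdGraph_two_adj_east _ _⟩ :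
          (zdGraph 2).Dart) = ![k - n / 2, n / 2] := by
      rw [squareLatticeEmbedding_leftFace]
      change squareLeftFace ![k - n / 2, n / 2] ![k - n / 2 + 1, n / 2] = _
      rw [← vec2_add_single_zero, squareLeftFace_east]
    have hR : squareLatticeEmbedding.rightFace
        (⟨(![k - n / 2, n / 2], ![k - n / 2 + 1, n / 2]), zdGraph_two_adj_east _ _⟩ :
          (zdGraph 2).Dart) = ![k - n / 2, n / 2 - 1] := by
      rw [squareLatticeEmbedding_rightFace]
      change squareLeftFace ![k - n / 2 + 1, n / 2] ![k - n / 2, n / 2] = _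
      rw [← vec2_add_single_zero, squareLeftFace_west, vec2_sub_single_one]
    obtain ⟨o1, o2, o3, o4⟩ := squareLatticeEmbedding.dartOppositeSide_apply
      (⟨(![k - n / 2, n / 2], ![k - n / 2 + 1, n / 2]), zdGraph_two_adj_east _ _⟩ :
        (zdGraph 2).Dart)
      (by
        rw [hL, hR]; intro hLR
        have := congrFun hLR 1
        simp only [Matrix.cons_val_one, Matrix.cons_val_zero] at this
        omega)
    rw [hL, hR] at o1 o2 o3 o4
    change squareLatticeEmbedding.dartOppositeSide _ (![k - n / 2, n / 2], _) =
      (![k - n / 2 + 1, n / 2], _) at o1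
    change squareLatticeEmbedding.dartOppositeSide _ (![k - n / 2 + 1, n / 2], _) =
      (![k - n / 2, n / 2], _) at o2
    change squareLatticeEmbedding.dartOppositeSide _ (![k - n / 2 + 1, n / 2], _) =
      (![k - n / 2, n / 2], _) at o3
    change squareLatticeEmbedding.dartOppositeSide _ (![k - n / 2, n / 2], _) =
      (![k - n / 2 + 1, n / 2], _) at o4
    clear hd hL hR
    have hv : v = ![v 0, n / 2] := (vec2_eq_iff _ _ _).2 ⟨rfl, hv1⟩
    have hf : f = ![k - n / 2, f 1] := (vec2_eq_iff _ _ _).2 ⟨hf0, rfl⟩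
    rcases hv0 with hv0 | hv0 <;> rcases hf1 with hf1 | hf1 <;> rw [hv0] at hv <;>
      rw [hf1] at hf <;> rw [hv, hf] <;> [rw [o1]; rw [o4]; rw [o3]; rw [o2]] <;>
      clear o1 o2 o3 o4 <;>
      simp only [Prod.mk.injEq, vec2_eq_iff, Matrix.cons_val_zero, Matrix.cons_val_one] <;>
      omega
  · -- vertical rhombus, north dart `(a, b) → (a, b + 1)` with `a = k - n/2`, `b = n/2`
    have hv0 : v 0 = k - n / 2 := by omega
    have hf1 : f 1 = n / 2 := by omega
    have hv1 : v 1 = n / 2 ∨ v 1 = n / 2 + 1 := by omega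
    have hf0 : f 0 = k - n / 2 - 1 ∨ f 0 = k - n / 2 := by omega
    clear h'
    have hd : (⟨(![k - n / 2, n / 2], ![k - n / 2, n / 2 + 1]), zdGraph_two_adj_north _ _⟩ :
        (zdGraph 2).Dart).edge =
          ((squareAntidiagTrack k n : (zdGraph 2).edgeSet) : Sym2 (Site 2)) := by
      rw [squareAntidiagTrack_of_odd hn]; rfl
    rw [squareLatticeEmbedding.oppositeSide_eq_dartOppositeSide
      isIsoradial_squareLatticeEmbedding_holds hd]
    have hL : squareLatticeEmbedding.leftFace
        (⟨(![k - n / 2, n / 2], ![k - n / 2, n / 2 + 1]), zdGraph_two_adj_north _ _⟩ :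
          (zdGraph 2).Dart) = ![k - n / 2 - 1, n / 2] := by
      rw [squareLatticeEmbedding_leftFace]
      change squareLeftFace ![k - n / 2, n / 2] ![k - n / 2, n / 2 + 1] = _
      rw [← vec2_add_single_one, squareLeftFace_north, vec2_sub_single_zero]
    have hR : squareLatticeEmbedding.rightFace
        (⟨(![k - n / 2, n / 2], ![k - n / 2, n / 2 + 1]), zdGraph_two_adj_north _ _⟩ :
          (zdGraph 2).Dart) = ![k - n / 2, n / 2] := by
      rw [squareLatticeEmbedding_rightFace]
      change squareLeftFace ![k - n / 2, n / 2 + 1] ![k - n / 2, n / 2] = _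
      rw [← vec2_add_single_one, squareLeftFace_south]
    obtain ⟨o1, o2, o3, o4⟩ := squareLatticeEmbedding.dartOppositeSide_apply
      (⟨(![k - n / 2, n / 2], ![k - n / 2, n / 2 + 1]), zdGraph_two_adj_north _ _⟩ :
        (zdGraph 2).Dart)
      (by
        rw [hL, hR]; intro hLR
        have := congrFun hLR 0
        simp only [Matrix.cons_val_zero] at this
        omega)
    rw [hL, hR] at o1 o2 o3 o4
    change squareLatticeEmbedding.dartOppositeSide _ (![k - n / 2, n / 2], _) =
      (![k - n / 2, n / 2 + 1], _) at o1
    change squareLatticeEmbedding.dartOppositeSide _ (![k - n / 2, n / 2 + 1], _) =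
      (![k - n / 2, n / 2], _) at o2
    change squareLatticeEmbedding.dartOppositeSide _ (![k - n / 2, n / 2 + 1], _) =
      (![k - n / 2, n / 2], _) at o3
    change squareLatticeEmbedding.dartOppositeSide _ (![k - n / 2, n / 2], _) =
      (![k - n / 2, n / 2 + 1], _) at o4
    clear hd hL hR
    have hv : v = ![k - n / 2, v 1] := (vec2_eq_iff _ _ _).2 ⟨hv0, rfl⟩
    have hf : f = ![f 0, n / 2] := (vec2_eq_iff _ _ _).2 ⟨rfl, hf1⟩
    rcases hv1 with hv1 | hv1 <;> rcases hf0 with hf0 | hf0 <;> rw [hv1] at hv <;>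
      rw [hf0] at hf <;> rw [hv, hf] <;> [rw [o1]; rw [o4]; rw [o3]; rw [o2]] <;>
      clear o1 o2 o3 o4 <;>
      simp only [Prod.mk.injEq, vec2_eq_iff, Matrix.cons_val_zero, Matrix.cons_val_one] <;>
      omega

/-! ### The diagonal and antidiagonal tracks -/

/-- The antidiagonals of `ℤ²` are train tracks, with the explicit side chain of the docstring
of `squareAntidiagTrack`: the `n`-th shared side is (vertex `(k - ⌊n/2⌋, ⌊(n+1)/2⌋)`, face
`(k - ⌊(n+1)/2⌋, ⌊n/2⌋)`), the bottom side of the `n`-th rhombus and the top side of the next.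
(de Bruijn 1981; Grimmett–Manolescu 2014, §2.1 and §2.4.) [cite: GrimmettManolescu2014, §2.4] -/
theorem isTrack_squareAntidiagTrack (k : ℤ) :
    squareLatticeEmbedding.IsTrack (squareAntidiagTrack k) := by
  refine ⟨fun n => (![k - n / 2, (n + 1) / 2], ![k - (n + 1) / 2, n / 2]),
    fun n => ⟨?_, ?_, ?_, ?_⟩⟩
  · rw [mem_sides_squareAntidiagTrack_iff]
    simp only [Matrix.cons_val_zero, Matrix.cons_val_one]
    omega
  · rw [mem_sides_squareAntidiagTrack_iff]
    simp only [Matrix.cons_val_zero, Matrix.cons_val_one]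
    omega
  · intro h
    have := (squareAntidiagTrack_inj h).2
    omega
  · rw [oppositeSide_squareAntidiagTrack]
    · simp only [Matrix.cons_val_zero, Matrix.cons_val_one, Prod.mk.injEq, vec2_eq_iff]
      omega
    · rw [mem_sides_squareAntidiagTrack_iff]
      simp only [Matrix.cons_val_zero, Matrix.cons_val_one]
      omega

/-- The diagonals of `ℤ²` are train tracks, with the explicit side chain of the docstring of
`squareDiagTrack`. (Grimmett–Manolescu 2014, §2.1 and §2.4.) [cite: GrimmettManolescu2014, §2.4] -/
theorem isTrack_squareDiagTrack (k : ℤ) :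
    squareLatticeEmbedding.IsTrack (squareDiagTrack k) := by
  refine ⟨fun n => (![k + (n + 2) / 2, (n + 1) / 2], ![k + (n + 1) / 2, n / 2]),
    fun n => ⟨?_, ?_, ?_, ?_⟩⟩
  · rw [squareDiagTrack_eq, mem_sides_squareAntidiagTrack_iff]
    simp only [Matrix.cons_val_zero, Matrix.cons_val_one]
    omega
  · rw [squareDiagTrack_eq, mem_sides_squareAntidiagTrack_iff]
    simp only [Matrix.cons_val_zero, Matrix.cons_val_one]
    omega
  · intro h
    rw [squareDiagTrack_eq, squareDiagTrack_eq] at h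
    have := (squareAntidiagTrack_inj h).2
    omega
  · rw [squareDiagTrack_eq, oppositeSide_squareAntidiagTrack]
    · simp only [Matrix.cons_val_zero, Matrix.cons_val_one, Prod.mk.injEq, vec2_eq_iff]
      omega
    · rw [mem_sides_squareAntidiagTrack_iff]
      simp only [Matrix.cons_val_zero, Matrix.cons_val_one]
      omega

/-- An antidiagonal track visits each rhombus at most once. (Grimmett–Manolescu 2014, §2.4.) [cite: GrimmettManolescu2014, §2.4] -/
theorem squareAntidiagTrack_injective (k : ℤ) : Function.Injective (squareAntidiagTrack k) :=
  fun _ _ h => (squareAntidiagTrack_inj h).2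

/-- A diagonal track visits each rhombus at most once. (Grimmett–Manolescu 2014, §2.4.) [cite: GrimmettManolescu2014, §2.4] -/
theorem squareDiagTrack_injective (k : ℤ) : Function.Injective (squareDiagTrack k) := by
  intro m n h
  rw [squareDiagTrack_eq, squareDiagTrack_eq] at h
  exact (squareAntidiagTrack_inj h).2

/-- **The antidiagonals of `ℤ²` are simple tracks** — discharge of the named fact
`isSimpleTrack_squareAntidiagTrack`. (Grimmett–Manolescu 2014, §2.1 and §2.4.) [cite: GrimmettManolescu2014, §2.4] -/
theorem isSimpleTrack_squareAntidiagTrack_holds : isSimpleTrack_squareAntidiagTrack :=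
  fun k => ⟨isTrack_squareAntidiagTrack k, squareAntidiagTrack_injective k⟩

/-- **The diagonals of `ℤ²` are simple tracks** — discharge of the named fact
`isSimpleTrack_squareDiagTrack`. (Grimmett–Manolescu 2014, §2.1 and §2.4.) [cite: GrimmettManolescu2014, §2.4] -/
theorem isSimpleTrack_squareDiagTrack_holds : isSimpleTrack_squareDiagTrack :=
  fun k => ⟨isTrack_squareDiagTrack k, squareDiagTrack_injective k⟩

/-- Distinct antidiagonal tracks do not meet. (Grimmett–Manolescu 2014, §2.4, the square grid of
`ℤ²`.) [cite: GrimmettManolescu2014, §2.4] -/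
theorem not_trackMeets_squareAntidiagTrack {i j : ℤ} (hij : i ≠ j) :
    ¬ trackMeets (squareAntidiagTrack i) (squareAntidiagTrack j) := by
  rintro ⟨m, n, h⟩
  exact hij (squareAntidiagTrack_inj h).1

/-- Distinct diagonal tracks do not meet. (Grimmett–Manolescu 2014, §2.4.) [cite: GrimmettManolescu2014, §2.4] -/
theorem not_trackMeets_squareDiagTrack {i j : ℤ} (hij : i ≠ j) :
    ¬ trackMeets (squareDiagTrack i) (squareDiagTrack j) := by
  rintro ⟨m, n, h⟩
  rw [squareDiagTrack_eq, squareDiagTrack_eq] at h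
  have := squareAntidiagTrack_inj h
  omega

/-- The antidiagonal track `i` and the diagonal track `j` share the rhombus at index `i - j` of
both. (Grimmett–Manolescu 2014, §2.4.) [cite: GrimmettManolescu2014, §2.4] -/
theorem squareAntidiagTrack_eq_squareDiagTrack (i j : ℤ) :
    squareAntidiagTrack i (i - j) = squareDiagTrack j (i - j) := by
  rw [squareDiagTrack_eq, add_sub_cancel]

/-- Every antidiagonal track meets every diagonal track. (Grimmett–Manolescu 2014, §2.4.) [cite: GrimmettManolescu2014, §2.4] -/
theorem trackMeets_squareAntidiagTrack_squareDiagTrack (i j : ℤ) :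
    trackMeets (squareAntidiagTrack i) (squareDiagTrack j) :=
  ⟨i - j, i - j, squareAntidiagTrack_eq_squareDiagTrack i j⟩

/-- The antidiagonal track `i` meets the diagonal track `j` exactly at its index `i - j`.
(Grimmett–Manolescu 2014, §2.4.) [cite: GrimmettManolescu2014, §2.4] -/
theorem meetIndices_squareAntidiagTrack_squareDiagTrack (i j : ℤ) :
    meetIndices (squareAntidiagTrack i) (squareDiagTrack j) = {i - j} := by
  ext m
  simp only [meetIndices, Set.mem_setOf_eq, Set.mem_singleton_iff]
  constructor
  · rintro ⟨n, h⟩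
    rw [squareDiagTrack_eq] at h
    have := squareAntidiagTrack_inj h
    omega
  · rintro rfl
    exact ⟨i - j, squareAntidiagTrack_eq_squareDiagTrack i j⟩

/-- The diagonal track `i` meets the antidiagonal track `j` exactly at its index `j - i`.
(Grimmett–Manolescu 2014, §2.4.) [cite: GrimmettManolescu2014, §2.4] -/
theorem meetIndices_squareDiagTrack_squareAntidiagTrack (i j : ℤ) :
    meetIndices (squareDiagTrack i) (squareAntidiagTrack j) = {j - i} := by
  ext m
  simp only [meetIndices, Set.mem_setOf_eq, Set.mem_singleton_iff]
  constructor
  · rintro ⟨n, h⟩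
    rw [squareDiagTrack_eq] at h
    have := squareAntidiagTrack_inj h
    omega
  · rintro rfl
    exact ⟨j - i, (squareAntidiagTrack_eq_squareDiagTrack j i).symm⟩

/-- Along an antidiagonal track, the meetings with two consecutive diagonal tracks occur at
consecutive indices, so no rhombus lies strictly between them (separation bound `M = 0`).
(Grimmett–Manolescu 2014, §2.4.) [cite: GrimmettManolescu2014, §2.4] -/
theorem trackBetween_squareAntidiagTrack (i j : ℤ) :
    trackBetween (squareAntidiagTrack i) (squareDiagTrack j) (squareDiagTrack (j + 1)) = ∅ := by
  ext m
  simp only [trackBetween, meetIndices_squareAntidiagTrack_squareDiagTrack, Set.mem_singleton_iff,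
    exists_eq_left, Set.mem_setOf_eq, Set.mem_empty_iff_false, iff_false]
  omega

/-- Along a diagonal track, the meetings with two consecutive antidiagonal tracks occur at
consecutive indices. (Grimmett–Manolescu 2014, §2.4.) [cite: GrimmettManolescu2014, §2.4] -/
theorem trackBetween_squareDiagTrack (i j : ℤ) :
    trackBetween (squareDiagTrack i) (squareAntidiagTrack j) (squareAntidiagTrack (j + 1)) = ∅ := by
  ext m
  simp only [trackBetween, meetIndices_squareDiagTrack_squareAntidiagTrack, Set.mem_singleton_iff,
    exists_eq_left, Set.mem_setOf_eq, Set.mem_empty_iff_false, iff_false]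
  omega

/-! ### Classification of the train tracks of `ℤ²` -/

/-- The four sides of the rhombus `squareAntidiagTrack k n`, sorted by type: bottom / top (constant
`x₀ - x₁`) and right / left (constant `x₀ + x₁`). (Grimmett–Manolescu 2014, §2.1.) [cite: GrimmettManolescu2014, §2.1] -/
theorem sideType_of_mem_sides {k n : ℤ} {p : Site 2 × Site 2}
    (h : p ∈ squareLatticeEmbedding.sides (squareAntidiagTrack k n)) :
    (p.1 0 - p.1 1 = k - n ∧ p.2 0 - p.2 1 = k - n) ∨
      (p.1 0 - p.1 1 = k - n + 1 ∧ p.2 0 - p.2 1 = k - n + 1) ∨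
      (p.1 0 + p.1 1 = k + 1 ∧ p.2 0 + p.2 1 = k) ∨
      (p.1 0 + p.1 1 = k ∧ p.2 0 + p.2 1 + 1 = k) := by
  obtain ⟨v, f⟩ := p
  have h' := mem_sides_squareAntidiagTrack_iff.1 h
  simp only
  omega

/-- A rhombus of `ℤ²` distinct from `squareAntidiagTrack k n` and sharing its bottom side is the
next rhombus `squareAntidiagTrack k (n + 1)` of the same antidiagonal track. (Grimmett–Manolescu
2014, §2.1: each side of the diamond graph lies in exactly two rhombi.) [cite: GrimmettManolescu2014, §2.1] -/
theorem eq_of_shared_bottom {k n k' n' : ℤ} {p : Site 2 × Site 2}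
    (h1 : p ∈ squareLatticeEmbedding.sides (squareAntidiagTrack k n))
    (h2 : p ∈ squareLatticeEmbedding.sides (squareAntidiagTrack k' n'))
    (hne : squareAntidiagTrack k n ≠ squareAntidiagTrack k' n')
    (hs : p.1 0 - p.1 1 = k - n ∧ p.2 0 - p.2 1 = k - n) : k' = k ∧ n' = n + 1 := by
  obtain ⟨v, f⟩ := p
  have h1' := mem_sides_squareAntidiagTrack_iff.1 h1
  have h2' := mem_sides_squareAntidiagTrack_iff.1 h2
  have hne' : ¬ (k = k' ∧ n = n') := fun h => hne (by rw [h.1, h.2])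
  simp only at hs
  omega

/-- A rhombus distinct from `squareAntidiagTrack k n` and sharing its top side is the previous
rhombus `squareAntidiagTrack k (n - 1)` of the same antidiagonal track. (Grimmett–Manolescu
2014, §2.1.) [cite: GrimmettManolescu2014, §2.1] -/
theorem eq_of_shared_top {k n k' n' : ℤ} {p : Site 2 × Site 2}
    (h1 : p ∈ squareLatticeEmbedding.sides (squareAntidiagTrack k n))
    (h2 : p ∈ squareLatticeEmbedding.sides (squareAntidiagTrack k' n'))
    (hne : squareAntidiagTrack k n ≠ squareAntidiagTrack k' n')
    (hs : p.1 0 - p.1 1 = k - n + 1 ∧ p.2 0 - p.2 1 = k - n + 1) : k' = k ∧ n' = n - 1 := by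
  obtain ⟨v, f⟩ := p
  have h1' := mem_sides_squareAntidiagTrack_iff.1 h1
  have h2' := mem_sides_squareAntidiagTrack_iff.1 h2
  have hne' : ¬ (k = k' ∧ n = n') := fun h => hne (by rw [h.1, h.2])
  simp only at hs
  omega

/-- A rhombus distinct from `squareAntidiagTrack k n` and sharing its right side is the next
rhombus `squareAntidiagTrack (k + 1) (n + 1)` of the same diagonal track. (Grimmett–Manolescu
2014, §2.1.) [cite: GrimmettManolescu2014, §2.1] -/
theorem eq_of_shared_right {k n k' n' : ℤ} {p : Site 2 × Site 2}
    (h1 : p ∈ squareLatticeEmbedding.sides (squareAntidiagTrack k n))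
    (h2 : p ∈ squareLatticeEmbedding.sides (squareAntidiagTrack k' n'))
    (hne : squareAntidiagTrack k n ≠ squareAntidiagTrack k' n')
    (hs : p.1 0 + p.1 1 = k + 1 ∧ p.2 0 + p.2 1 = k) : k' = k + 1 ∧ n' = n + 1 := by
  obtain ⟨v, f⟩ := p
  have h1' := mem_sides_squareAntidiagTrack_iff.1 h1
  have h2' := mem_sides_squareAntidiagTrack_iff.1 h2
  have hne' : ¬ (k = k' ∧ n = n') := fun h => hne (by rw [h.1, h.2])
  simp only at hs
  omega

/-- A rhombus distinct from `squareAntidiagTrack k n` and sharing its left side is the previous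
rhombus `squareAntidiagTrack (k - 1) (n - 1)` of the same diagonal track. (Grimmett–Manolescu
2014, §2.1.) [cite: GrimmettManolescu2014, §2.1] -/
theorem eq_of_shared_left {k n k' n' : ℤ} {p : Site 2 × Site 2}
    (h1 : p ∈ squareLatticeEmbedding.sides (squareAntidiagTrack k n))
    (h2 : p ∈ squareLatticeEmbedding.sides (squareAntidiagTrack k' n'))
    (hne : squareAntidiagTrack k n ≠ squareAntidiagTrack k' n')
    (hs : p.1 0 + p.1 1 = k ∧ p.2 0 + p.2 1 + 1 = k) : k' = k - 1 ∧ n' = n - 1 := by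
  obtain ⟨v, f⟩ := p
  have h1' := mem_sides_squareAntidiagTrack_iff.1 h1
  have h2' := mem_sides_squareAntidiagTrack_iff.1 h2
  have hne' : ¬ (k = k' ∧ n = n') := fun h => hne (by rw [h.1, h.2])
  simp only at hs
  omega

/-- `oppositeSide_squareAntidiagTrack` componentwise, for a side given as a point of `V × F`.
(Grimmett–Manolescu 2014, §2.1.) [cite: GrimmettManolescu2014, §2.1] -/
theorem oppositeSide_squareAntidiagTrack' {k n : ℤ} {p : Site 2 × Site 2}
    (h : p ∈ squareLatticeEmbedding.sides (squareAntidiagTrack k n)) :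
    (squareLatticeEmbedding.oppositeSide (squareAntidiagTrack k n) p).1 0 = 2 * k - n + 1 - p.1 0 ∧
    (squareLatticeEmbedding.oppositeSide (squareAntidiagTrack k n) p).1 1 = n - p.1 1 ∧
    (squareLatticeEmbedding.oppositeSide (squareAntidiagTrack k n) p).2 0 = 2 * k - n - p.2 0 ∧
    (squareLatticeEmbedding.oppositeSide (squareAntidiagTrack k n) p).2 1 = n - 1 - p.2 1 := by
  obtain ⟨v, f⟩ := p
  rw [oppositeSide_squareAntidiagTrack h]
  simp

/-- **Classification of the tracks of `ℤ²`.** Every train track of the isoradial square lattice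
runs along a diagonal or an antidiagonal, monotonically: in terms of the parametrisation of the
rhombi by the antidiagonal tracks, `r j = squareAntidiagTrack (m₀ + j a) (n₀ + j b)` with
`(a, b) ∈ {(0, 1), (0, -1), (1, 1), (-1, -1)}`. Proof: consecutive rhombi of a track are
neighbours across the shared side (`eq_of_shared_bottom` etc.), the exit side is the reflection
of the entry side (`oppositeSide_squareAntidiagTrack`), so the displacement between consecutive
rhombi is constant along the track (two-sided induction over `ℤ`). (de Bruijn 1981, §4;
Grimmett–Manolescu 2014, §2.4: "the track system of the square lattice is the set of its
diagonals"; Kenyon–Schlenker 2005, §3.) [cite: GrimmettManolescu2014, §2.4] -/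
theorem isTrack_squareLattice_classification {r : ℤ → (zdGraph 2).edgeSet}
    (hr : squareLatticeEmbedding.IsTrack r) :
    ∃ m₀ n₀ a b : ℤ, ((a = 0 ∧ b = 1) ∨ (a = 0 ∧ b = -1) ∨ (a = 1 ∧ b = 1) ∨ (a = -1 ∧ b = -1)) ∧
      ∀ j, r j = squareAntidiagTrack (m₀ + j * a) (n₀ + j * b) := by
  obtain ⟨σ, hσ⟩ := hr
  choose m n hmn using fun j => exists_eq_squareAntidiagTrack (r j)
  -- one step of the track: the displacement is determined by the type of the exit side,
  -- and the entry and exit sides have opposite types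
  have step : ∀ j, (m (j + 1) - m j = m j - m (j - 1) ∧ n (j + 1) - n j = n j - n (j - 1)) ∧
      ((m (j + 1) = m j ∧ n (j + 1) = n j + 1) ∨ (m (j + 1) = m j ∧ n (j + 1) = n j - 1) ∨
        (m (j + 1) = m j + 1 ∧ n (j + 1) = n j + 1) ∨
          (m (j + 1) = m j - 1 ∧ n (j + 1) = n j - 1)) := by
    intro j
    obtain ⟨hin₀, hin, hne₀, -⟩ := hσ (j - 1)
    rw [sub_add_cancel] at hin hne₀
    obtain ⟨hout, hout', hne₁, hopp⟩ := hσ j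
    rw [hmn j] at hin hout hopp
    rw [hmn (j - 1)] at hin₀ hne₀
    rw [hmn (j + 1)] at hout' hne₁
    rw [hmn j] at hne₀ hne₁
    have hne₀' : squareAntidiagTrack (m j) (n j) ≠ squareAntidiagTrack (m (j - 1)) (n (j - 1)) :=
      fun h => hne₀ h.symm
    have ho := oppositeSide_squareAntidiagTrack' hin
    rw [← hopp] at ho
    obtain ⟨ho1, ho2, ho3, ho4⟩ := ho
    rcases sideType_of_mem_sides hin with hs | hs | hs | hs
    · obtain ⟨h1, h2⟩ := eq_of_shared_bottom hin hin₀ hne₀' hs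
      obtain ⟨h3, h4⟩ := eq_of_shared_top hout hout' hne₁ (by omega)
      omega
    · obtain ⟨h1, h2⟩ := eq_of_shared_top hin hin₀ hne₀' hs
      obtain ⟨h3, h4⟩ := eq_of_shared_bottom hout hout' hne₁ (by omega)
      omega
    · obtain ⟨h1, h2⟩ := eq_of_shared_right hin hin₀ hne₀' hs
      obtain ⟨h3, h4⟩ := eq_of_shared_left hout hout' hne₁ (by omega)
      omega
    · obtain ⟨h1, h2⟩ := eq_of_shared_left hin hin₀ hne₀' hs
      obtain ⟨h3, h4⟩ := eq_of_shared_right hout hout' hne₁ (by omega)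
      omega
  -- the displacement is constant along the track
  have const : ∀ j, m (j + 1) - m j = m 1 - m 0 ∧ n (j + 1) - n j = n 1 - n 0 := by
    intro j
    induction j using Int.induction_on with
    | zero => simp
    | succ i ih =>
      have := (step (i + 1)).1
      rw [add_sub_cancel_right] at this
      omega
    | pred i ih =>
      have := (step (-i)).1
      have h1 : -(i : ℤ) - 1 + 1 = -i := by ring
      rw [h1]
      omega
  have closed : ∀ j, m j = m 0 + j * (m 1 - m 0) ∧ n j = n 0 + j * (n 1 - n 0) := by
    intro j
    induction j using Int.induction_on with
    | zero => simp
    | succ i ih =>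
      obtain ⟨c1, c2⟩ := const i
      exact ⟨by linear_combination ih.1 + c1, by linear_combination ih.2 + c2⟩
    | pred i ih =>
      obtain ⟨c1, c2⟩ := const (-(i : ℤ) - 1)
      rw [sub_add_cancel] at c1 c2
      exact ⟨by linear_combination ih.1 - c1, by linear_combination ih.2 - c2⟩
  refine ⟨m 0, n 0, m 1 - m 0, n 1 - n 0, ?_, fun j => ?_⟩
  · have := (step 0).2
    simp only [zero_add] at this
    omega
  · rw [hmn j, ← (closed j).1, ← (closed j).2]

/-! ### The square-grid property of `ℤ²` -/

/-- **`ℤ²` has the square-grid property** — discharge of the named fact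
`hasSquareGridProperty_squareLattice`, with `s = squareAntidiagTrack`, `t = squareDiagTrack` and
separation bound `M = 0`: both families consist of simple tracks, tracks of one family are
pairwise disjoint, `s i` meets `t j` (exactly at index `i - j`), betweenness holds for every
track by the classification `isTrack_squareLattice_classification` (a track meeting two distinct
antidiagonal tracks runs along a diagonal and hence meets all of them, and symmetrically), and
consecutive meetings are at consecutive indices. (Grimmett–Manolescu, PTRF 159 (2014), §1 and
§2.4: "the square lattice … has the square grid property".) [cite: GrimmettManolescu2014, §2.4] -/
theorem hasSquareGridProperty_squareLattice_holds : hasSquareGridProperty_squareLattice := by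
  refine ⟨squareAntidiagTrack, squareDiagTrack, isSimpleTrack_squareAntidiagTrack_holds,
    isSimpleTrack_squareDiagTrack_holds, fun i j hij => not_trackMeets_squareAntidiagTrack hij,
    fun i j hij => not_trackMeets_squareDiagTrack hij,
    trackMeets_squareAntidiagTrack_squareDiagTrack, ?_, ?_, ⟨0, fun i j => ?_, fun i j => ?_⟩⟩
  · -- betweenness for the antidiagonal family
    intro i j k hij hjk r hr hi hk
    obtain ⟨m₀, n₀, a, b, hab, hr'⟩ := isTrack_squareLattice_classification hr
    obtain ⟨l₁, m₁, h₁⟩ := hi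
    obtain ⟨l₂, m₂, h₂⟩ := hk
    rw [hr'] at h₁ h₂
    have e₁ := squareAntidiagTrack_inj h₁
    have e₂ := squareAntidiagTrack_inj h₂
    rcases hab with ⟨rfl, rfl⟩ | ⟨rfl, rfl⟩ | ⟨rfl, rfl⟩ | ⟨rfl, rfl⟩
    · simp only [mul_zero, add_zero] at e₁ e₂; omega
    · simp only [mul_zero, add_zero] at e₁ e₂; omega
    · refine ⟨j - m₀, n₀ + (j - m₀), ?_⟩
      rw [hr']
      congr 1 <;> ring
    · refine ⟨m₀ - j, n₀ - (m₀ - j), ?_⟩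
      rw [hr']
      congr 1 <;> ring
  · -- betweenness for the diagonal family
    intro i j k hij hjk r hr hi hk
    obtain ⟨m₀, n₀, a, b, hab, hr'⟩ := isTrack_squareLattice_classification hr
    obtain ⟨l₁, m₁, h₁⟩ := hi
    obtain ⟨l₂, m₂, h₂⟩ := hk
    rw [hr', squareDiagTrack_eq] at h₁ h₂
    have e₁ := squareAntidiagTrack_inj h₁
    have e₂ := squareAntidiagTrack_inj h₂
    rcases hab with ⟨rfl, rfl⟩ | ⟨rfl, rfl⟩ | ⟨rfl, rfl⟩ | ⟨rfl, rfl⟩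
    · refine ⟨m₀ - j - n₀, m₀ - j, ?_⟩
      rw [hr', squareDiagTrack_eq, mul_zero, add_zero, mul_one]
      congr 1 <;> ring
    · refine ⟨-(m₀ - j - n₀), m₀ - j, ?_⟩
      rw [hr', squareDiagTrack_eq, mul_zero, add_zero, mul_neg_one, neg_neg]
      congr 1 <;> ring
    · simp only [mul_one] at e₁ e₂; omega
    · simp only [mul_neg_one] at e₁ e₂; omega
  · rw [trackBetween_squareAntidiagTrack, Set.encard_empty]
    exact zero_le
  · rw [trackBetween_squareDiagTrack, Set.encard_empty]
    exact zero_le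

end Literature.Probability.LatticeModels
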